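import Literature.MathematicalPhysics.QuantumFieldTheory.ConformalBootstrap3D.PointKernelK34v2Data
import Literature.MathematicalPhysics.QuantumFieldTheory.ConformalBootstrap3D.PointKernelParts

/-!
# K34v2 certificate, kernel part file P5: one-cell head segments 98 in level ranges

The head cells whose kernel evaluation exceeds one `decide` are one-cell segments of `hsegsK34v2`; each is
checked by `PCert.hPartSideOK` (side conditions) and `PCert.hPartOK` per level range `[n_lo, n_lo + count)`
against an integer claim, the claims summing to `≥ 0` (`PointKernel.partsOK`); soundness is
`PCert.hParts_sound` (`PointKernelParts`).  The part files `P1, P2, …` are mutually independent (each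
imports only the data file); the ranges of one cell may span several of them, and the per-cell
conclusions `hparts_i` / `hcell_i` of those cells are assembled in `PointKernelK34v2.lean`.
Estimated kernel time 248 s.
-/

set_option maxRecDepth 100000
set_option maxHeartbeats 0

namespace Literature.MathematicalPhysics.QuantumFieldTheory.ConformalBootstrap3D.PointKernelK34v2

open Literature.MathematicalPhysics.QuantumFieldTheory.ConformalBootstrap3D.PointKernel

/-- one-cell segment 98 (row 4, cell `[10241/2048, 5121/1024]`, chord, `n_F = 58`,
4 level ranges): side conditions. [folklore] -/
theorem pside_98 : certK34v2.hPartSideOK (PCert.segAt hsegsK34v2 98) JHK34v2 = true := by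
  decide +kernel

/-- its level ranges `(n_lo, count, claim)`. [folklore] -/
def parts_98 : List (ℕ × ℕ × ℤ) := [(0, 31, -2948639577655538467603663212862365658), (31, 12, 2257426235406135715290745586959795059), (43, 9, 536691691976128740881316912771513235), (52, 7, 154521650273274011431600713131057364)]

/-- the ranges tile `[0, n_F]` and the claims sum to `≥ 0`. [folklore] -/
theorem pcov_98 : PointKernel.partsOK 58 parts_98 = true := by
  decide +kernel

/-- levels `[0, 31)` of segment 98: partial lower sum `≥` claim. [folklore] -/
theorem part_98_0 : certK34v2.hPartOK (PCert.segAt hsegsK34v2 98) JHK34v2 0 31 (-2948639577655538467603663212862365658) = true := by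
  decide +kernel

/-- levels `[31, 43)` of segment 98: partial lower sum `≥` claim. [folklore] -/
theorem part_98_1 : certK34v2.hPartOK (PCert.segAt hsegsK34v2 98) JHK34v2 31 12 (2257426235406135715290745586959795059) = true := by
  decide +kernel

/-- levels `[43, 52)` of segment 98: partial lower sum `≥` claim. [folklore] -/
theorem part_98_2 : certK34v2.hPartOK (PCert.segAt hsegsK34v2 98) JHK34v2 43 9 (536691691976128740881316912771513235) = true := by
  decide +kernel

/-- levels `[52, 59)` of segment 98: partial lower sum `≥` claim. [folklore] -/
theorem part_98_3 : certK34v2.hPartOK (PCert.segAt hsegsK34v2 98) JHK34v2 52 7 (154521650273274011431600713131057364) = true := by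
  decide +kernel

end Literature.MathematicalPhysics.QuantumFieldTheory.ConformalBootstrap3D.PointKernelK34v2
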